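import Literature.AnabelianGeometry.EtaleTheta.SettingModelTateProp15Quot
import Literature.AnabelianGeometry.EtaleTheta.SettingModelTateInvClauses
import Literature.AnabelianGeometry.EtaleTheta.SettingModelTateInversionAut
import HarnessLib

/-!
# [EtTh] Prop. 1.5 (ii) ∧ (iii) combined: «ι acts by −1 on F̈¹/F̈² = Ẑ·log(Ü)» (`InvNegatesFdd1Quot`) WITNESSED at the
# STAGE-2 model `modelχq p i j` for EVERY `(i, j)` — and ALL SEVEN typed clauses of Prop. 1.5 at ONE stage-2 datum

S. Mochizuki, *The étale theta function and its Frobenioid-theoretic manifestations*, Publ. RIMS **45** (2009) [EtTh], §1,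
Prop. 1.5 (ii)(iii), PRIMS PDF p. 23 (printed 249): «… any inversion automorphism ι of Π^tp_Y … fixes η̈^Θ + log(O^×_K̈),
but maps log(Ü) + log(O^×_K̈) to −log(Ü) + log(O^×_K̈)» [cite: MochizukiEtTh2009, Prop 1.5 (iii) p.23].

Layer L2 of the abc-iut cell, R78 cluster STAGE 2, seat abc-iut-L2-t6 (gen 7), row «PROP15-QUOT FROM A Y-COORDINATE KIT +
STAGE-2 INSTANCES», file 4 (the one-line corollary abc-iut-L2-d1 named 13:06:54Z). PROOF-ONLY (0 definitions).

* **`invNegatesFdd1Quot_modelχq`** — for EVERY `i`, EVERY even `j`, EVERY `Compat` witness and EVERY theta companion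
  `cι` of abc-iut-L2-d1's stage-2 inversion `inversionχq p i j` (`isInversionAut_inversionχq`, p446537): the root
  predicate `InvNegatesFdd1Quot hC hι cι` («for the induced action `T` on `H¹((Π^tp_Ÿ)^Θ, Δ_Θ)`, `T(d)·d ∈ F̈²` for every
  `d ∈ F̈¹`» — the K3 capstone binder `hιF1`) HOLDS at `modelχq`: abc-iut-L2-t1's `IsInversionAut.invNegatesFdd1Quot`
  (p440905) over this seat's `prop15iiQuot_kummerDataχq` (p447717). No `j = 2i` restriction (contrast: `InvClauses`
  clause (2) at stage 2 needs the defect-free shear `j = 2i`, abc-iut-L2-d1 `invClauses_modelχq_ofSection`); `…_symm` twin.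
* **`prop15_all_seven_inrSection_modelχq`** — at `(i, j) = (1, 2)`, at abc-iut-L2-t12's `inr`-section datum and the class
  of record `η̈♯ = etaDdχq`, for every companion `cι` of `inversionχq p 1 2`: Prop. 1.5 (i) ∧ (ii) ∧ (iii) ∧ (i)-Quot ∧
  (ii)-Quot ∧ `InvNegatesFdd1Quot` ∧ `InvClauses` — every typed clause of Prop. 1.5 in the tree that is not vacuous at a
  point-free model (`Prop15iiiInv` quantifies over `CuspidalPointDd`, empty here) holds TOGETHER at ONE datum; root census
  **`ThetaSetting.exists_isEtThOrigin_and_isTateOrigin_and_prop15_all_seven`**, and per-`(i, j)` NV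
  `ThetaSetting.exists_isEtThOrigin_invNegatesFdd1Quot_stageTwo`.
HONEST FRAMING: SEMI-SYNTHETIC model — consistency / non-vacuity evidence for the typed interface ONLY; nothing of [EtTh]
is asserted; typed ≠ proved; no side is taken on [IUTchIII] Cor. 3.12.
-/

noncomputable section

namespace Literature.AnabelianGeometry.EtaleTheta.SettingModel

open Literature.AnabelianGeometry.SemiGraphs _root_.Function

variable (p : ℕ) [Fact p.Prime] (i j : ℤ) (hj : Even j)

/-- **«ι acts by −1 on F̈¹/F̈²» at the stage-2 model, every `(i, j)`, every companion**: `InvNegatesFdd1Quot` for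
abc-iut-L2-d1's `inversionχq`. [cite: MochizukiEtTh2009, Prop 1.5 (iii) p.23] -/
theorem invNegatesFdd1Quot_modelχq (hC : (ThetaSetting.modelχq p i j hj).Compat)
    (cι : ThetaSetting.ThetaCompanion (Dα := ThetaSetting.modelχq p i j hj) (Dβ := ThetaSetting.modelχq p i j hj)
      (inversionχq p i j)) :
    (ThetaSetting.modelχq p i j hj).InvNegatesFdd1Quot hC (isInversionAut_inversionχq p i j hj) cι :=
  (isInversionAut_inversionχq p i j hj).invNegatesFdd1Quot cι (prop15iiQuot_kummerDataχq p i j hj hC)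

/-- The same for the inverse inversion `(inversionχq)⁻¹`. [cite: MochizukiEtTh2009, Prop 1.5 (iii) p.23] -/
theorem invNegatesFdd1Quot_modelχq_symm (hC : (ThetaSetting.modelχq p i j hj).Compat)
    (cι : ThetaSetting.ThetaCompanion (Dα := ThetaSetting.modelχq p i j hj) (Dβ := ThetaSetting.modelχq p i j hj)
      (inversionχq p i j).symm) :
    (ThetaSetting.modelχq p i j hj).InvNegatesFdd1Quot hC (isInversionAut_inversionχq_symm p i j hj) cι :=
  (isInversionAut_inversionχq_symm p i j hj).invNegatesFdd1Quot cι (prop15iiQuot_kummerDataχq p i j hj hC)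

/-- **Stage-2 NV for every `(i, j)`**: a theta setting of [EtTh] origin with an inversion automorphism, a theta companion
and a `Compat` witness at which «ι acts by −1 on F̈¹/F̈²» holds. [cite: MochizukiEtTh2009, Prop 1.5 (iii) p.23] -/
theorem _root_.Literature.AnabelianGeometry.EtaleTheta.ThetaSetting.exists_isEtThOrigin_invNegatesFdd1Quot_stageTwo
    (i j : ℤ) (hj : Even j) :
    ∃ (D : ThetaSetting p) (ι : D.PiTemp ≃ₜ* D.PiTemp) (hι : D.IsInversionAut ι) (cι : ThetaSetting.ThetaCompanion ι)
      (hC : D.Compat), D.IsEtThOrigin ∧ D.InvNegatesFdd1Quot hC hι cι :=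
  ⟨ThetaSetting.modelχq p i j hj, inversionχq p i j, isInversionAut_inversionχq p i j hj,
    (nonempty_thetaCompanion_inversionχq p i j hj).some, compat_modelχq p i j hj,
    ThetaSetting.modelχq_isEtThOrigin p i j hj, invNegatesFdd1Quot_modelχq p i j hj _ _⟩

/-! ### ALL SEVEN typed clauses of Prop. 1.5 at ONE datum of `modelχq p 1 2` -/

/-- **Prop. 1.5 (i) ∧ (ii) ∧ (iii) ∧ (i)-Quot ∧ (ii)-Quot ∧ InvNegatesFdd1Quot ∧ InvClauses TOGETHER** at the
`inr`-section datum of `modelχq p 1 2` with the class of record `η̈♯ = etaDdχq`, for every `Compat` witness and every theta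
companion of `inversionχq p 1 2` (five = `prop15_all_five_inrSection_modelχq`; the two ι-clauses = this file and
abc-iut-L2-d1's `invClauses_modelχq_ofSection` at the defect-free shear `j = 2i = 2`). [cite: MochizukiEtTh2009, Prop 1.5 p.23] -/
theorem prop15_all_seven_inrSection_modelχq (hC : (ThetaSetting.modelχq p 1 2 even_two).Compat)
    (cι : ThetaSetting.ThetaCompanion (Dα := ThetaSetting.modelχq p 1 2 even_two)
      (Dβ := ThetaSetting.modelχq p 1 2 even_two) (inversionχq p 1 2)) :
    ThetaSetting.Prop15i ((kummerCoreχq p 1 2 even_two).toKummerDataOfSection SemidirectProduct.inr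
        (continuous_inrχq p 1 2) (fun _ => rfl) (map_inr_GK_le_GtpY_modelχq' p 1 2 even_two)
        (map_inr_GKdd_le_GtpYdd_modelχq' p 1 2 even_two)) hC ∧
      ThetaSetting.Prop15ii ((kummerCoreχq p 1 2 even_two).toKummerDataOfSection SemidirectProduct.inr
        (continuous_inrχq p 1 2) (fun _ => rfl) (map_inr_GK_le_GtpY_modelχq' p 1 2 even_two)
        (map_inr_GKdd_le_GtpYdd_modelχq' p 1 2 even_two)) hC ∧
      ThetaSetting.Prop15iii (((kummerCoreχq p 1 2 even_two).toKummerDataOfSection SemidirectProduct.inr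
        (continuous_inrχq p 1 2) (fun _ => rfl) (map_inr_GK_le_GtpY_modelχq' p 1 2 even_two)
        (map_inr_GKdd_le_GtpYdd_modelχq' p 1 2 even_two)).etaleThetaDataOfClass (etaDdχq p 1 2 even_two)) hC ∧
      ThetaSetting.Prop15iQuot ((kummerCoreχq p 1 2 even_two).toKummerDataOfSection SemidirectProduct.inr
        (continuous_inrχq p 1 2) (fun _ => rfl) (map_inr_GK_le_GtpY_modelχq' p 1 2 even_two)
        (map_inr_GKdd_le_GtpYdd_modelχq' p 1 2 even_two)) hC ∧
      ThetaSetting.Prop15iiQuot ((kummerCoreχq p 1 2 even_two).toKummerDataOfSection SemidirectProduct.inr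
        (continuous_inrχq p 1 2) (fun _ => rfl) (map_inr_GK_le_GtpY_modelχq' p 1 2 even_two)
        (map_inr_GKdd_le_GtpYdd_modelχq' p 1 2 even_two)) hC ∧
      (ThetaSetting.modelχq p 1 2 even_two).InvNegatesFdd1Quot hC (isInversionAut_inversionχq p 1 2 even_two) cι ∧
      ThetaSetting.InvClauses
        (((kummerCoreχq p 1 2 even_two).toKummerDataOfSection SemidirectProduct.inr
          (continuous_inrχq p 1 2) (fun _ => rfl) (map_inr_GK_le_GtpY_modelχq' p 1 2 even_two)
          (map_inr_GKdd_le_GtpYdd_modelχq' p 1 2 even_two)).etaleThetaDataOfClass (etaDdχq p 1 2 even_two))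
        (isInversionAut_inversionχq p 1 2 even_two) cι :=
  have h5 := prop15_all_five_inrSection_modelχq p hC
  ⟨h5.1, h5.2.1, h5.2.2.1, h5.2.2.2.1, h5.2.2.2.2, invNegatesFdd1Quot_modelχq p 1 2 even_two hC cι,
    invClauses_modelχq_ofSection p 1 2 even_two cι _ _ _ _ _ (by norm_num)⟩

/-- **Root-level census form (all seven)**: SOME theta setting satisfying the §1 guard `IsEtThOrigin` AND the Tate clause
`IsTateOrigin` carries an inversion automorphism `ι` with a theta companion and an étale-theta datum `T` such that, at
`compat`, Prop. 1.5 (i) ∧ (ii) ∧ (iii) ∧ (i)-Quot ∧ (ii)-Quot hold for `T` and both ι-clauses («ι = −1 on F̈¹/F̈²»,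
`InvClauses`) hold for `ι` — witness the Tate-sheared model at `(i, j) = (1, 2)`. [cite: MochizukiEtTh2009, Prop 1.5 p.23] -/
theorem _root_.Literature.AnabelianGeometry.EtaleTheta.ThetaSetting.exists_isEtThOrigin_and_isTateOrigin_and_prop15_all_seven :
    ∃ D : ThetaSetting p, D.IsEtThOrigin ∧ D.IsTateOrigin ∧
      ∃ (ι : D.PiTemp ≃ₜ* D.PiTemp) (hι : D.IsInversionAut ι) (cι : ThetaSetting.ThetaCompanion ι) (T : D.EtaleThetaData),
        ThetaSetting.Prop15i T.toKummerData D.compat ∧ ThetaSetting.Prop15ii T.toKummerData D.compat ∧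
          ThetaSetting.Prop15iii T D.compat ∧ ThetaSetting.Prop15iQuot T.toKummerData D.compat ∧
            ThetaSetting.Prop15iiQuot T.toKummerData D.compat ∧ D.InvNegatesFdd1Quot D.compat hι cι ∧
              ThetaSetting.InvClauses T hι cι :=
  ⟨ThetaSetting.modelχq p 1 2 even_two, ThetaSetting.modelχq_isEtThOrigin p 1 2 even_two, modelχq_isTateOrigin p 1,
    inversionχq p 1 2, isInversionAut_inversionχq p 1 2 even_two, (nonempty_thetaCompanion_inversionχq p 1 2 even_two).some,
    ((kummerCoreχq p 1 2 even_two).toKummerDataOfSection SemidirectProduct.inr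
        (continuous_inrχq p 1 2) (fun _ => rfl) (map_inr_GK_le_GtpY_modelχq' p 1 2 even_two)
        (map_inr_GKdd_le_GtpYdd_modelχq' p 1 2 even_two)).etaleThetaDataOfClass (etaDdχq p 1 2 even_two),
    prop15_all_seven_inrSection_modelχq p _ _⟩

end Literature.AnabelianGeometry.EtaleTheta.SettingModel

end
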